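import Summits.Ventures.YMGap.Census.CubePattern
import HarnessLib

/-!
# Venture YMGap, track (b) — the equal-parity cube pattern of the even torus as a disjoint union of unit cubes with
# disjoint link sets

HONEST FRAMING: venture file of the cell `pub-ymgap` (QuantumFields programme), track (b); pure lattice combinatorics of the
torus `(ℤ/Lℤ)^d` (`L` even) — the bookkeeping behind the factorisation `∫ ∏_{p ∈ S₀} f_c(U_p) dU = Z_cube^{#cubes}` in the
cell's kernel version of Tomboulis's Prop. II.1 (ii) (arXiv:0707.2179 eq. (2.13), App. A (A.4)–(A.5)).  No integral here.

The pattern: three directions `i < j < k`, and the unit 3-cubes spanned by them whose base point `β` has EQUAL parities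
`β_i ≡ β_j ≡ β_k (mod 2)` (`cubeBases`); their faces form the cube pattern `cubePattern (dirs3 i j k) (parClass i j k)` of
`CubePattern` (`cubePattern_eq_biUnion`), two such cubes never share a face (`pairwiseDisjoint_cubeFaces`) nor a LINK: every
link in a direction of `{i, j, k}` belongs to exactly one pattern cube, `linkBase` (`linkBase_self`, `linkBase_shift`,
`linkBase_shift_shift`), so the link sets `cubeFiber β` are fibres of a function and disjoint for free.

References: E. T. Tomboulis, arXiv:0707.2179, App. A §1 [cite: Tomboulis2007Confinement, App. A §1].
-/

noncomputable section

open Finset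
open Literature.MathematicalPhysics.QuantumLattice
open Literature.MathematicalPhysics.QuantumFieldTheory
open Literature.MathematicalPhysics.QuantumFieldTheory.Tomboulis2007
open Literature.MathematicalPhysics.QuantumFieldTheory.WilsonRP

namespace Summit.Ventures.YMGap.Census

variable {d L : ℕ}

/-! ### The data of the equal-parity pattern -/

/-- The three cube directions as a `Finset`. -/
def dirs3 (i j k : Fin d) : Finset (Fin d) := {i, j, k}

/-- Membership in `dirs3`. -/
theorem mem_dirs3 {i j k a : Fin d} : a ∈ dirs3 i j k ↔ a = i ∨ a = j ∨ a = k := by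
  simp [dirs3]

/-- `dirs3 i j k` has three elements for `i < j < k`. -/
theorem card_dirs3 {i j k : Fin d} (hij : i < j) (hjk : j < k) : (dirs3 i j k).card = 3 := by
  unfold dirs3
  rw [card_insert_of_notMem (by simp [hij.ne, (hij.trans hjk).ne]), card_insert_of_notMem (by simp [hjk.ne]),
    card_singleton]

/-- The class set: parity vectors with equal `i`, `j`, `k` components. -/
def parClass (i j k : Fin d) : Finset (Fin d → ZMod 2) :=
  univ.filter fun w => w i = w j ∧ w j = w k

/-- Membership in `parClass`. -/
theorem mem_parClass {i j k : Fin d} {w : Fin d → ZMod 2} : w ∈ parClass i j k ↔ w i = w j ∧ w j = w k := by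
  simp [parClass]

/-- The class set ignores the coordinates outside `{i, j, k}`. -/
theorem isOutsideClosed_parClass (i j k : Fin d) : IsOutsideClosed (dirs3 i j k) (parClass i j k) := by
  intro w hw m hm
  rw [mem_dirs3, not_or, not_or] at hm
  rw [mem_parClass] at hw ⊢
  simpa [Pi.add_apply, Pi.single_apply, Ne.symm hm.1, Ne.symm hm.2.1, Ne.symm hm.2.2] using hw

/-- **The cube bases**: sites whose `i`, `j`, `k` coordinates have equal parities. -/
def cubeBases [NeZero L] (i j k : Fin d) : Finset (Site d L) :=
  univ.filter fun β => sitePar β i = sitePar β j ∧ sitePar β j = sitePar β k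

/-- Membership in `cubeBases` is membership of the parity vector in `parClass`. -/
theorem mem_cubeBases [NeZero L] {i j k : Fin d} {β : Site d L} :
    β ∈ cubeBases i j k ↔ sitePar β ∈ parClass i j k := by
  simp [cubeBases, parClass]

/-- On a cube base all three pattern parities agree. -/
theorem sitePar_eq_of_mem_cubeBases [NeZero L] {i j k : Fin d} {β : Site d L} (hβ : β ∈ cubeBases i j k) {a m : Fin d}
    (ha : a = i ∨ a = j ∨ a = k) (hm : m = i ∨ m = j ∨ m = k) : sitePar β a = sitePar β m := by
  rw [mem_cubeBases, mem_parClass] at hβ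
  obtain ⟨h1, h2⟩ := hβ
  rcases ha with rfl | rfl | rfl <;> rcases hm with rfl | rfl | rfl
  all_goals first | rfl | exact h1 | exact h1.symm | exact h2 | exact h2.symm | exact (h1.trans h2) | exact (h1.trans h2).symm

/-- **The six faces of the pattern cube with base `β`.** -/
def cubeFaces {i j k : Fin d} (hij : i < j) (hik : i < k) (hjk : j < k) (β : Site d L) : Finset (Plaquette d L) :=
  {(β, ⟨(i, j), hij⟩), (β.shift k, ⟨(i, j), hij⟩), (β, ⟨(i, k), hik⟩), (β.shift j, ⟨(i, k), hik⟩), (β, ⟨(j, k), hjk⟩),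
    (β.shift i, ⟨(j, k), hjk⟩)}

/-! ### The owner of a link -/

/-- **The base of the pattern cube owning the link `ℓ = (x, m)`** (`m ∈ {i, j, k}`): the coordinate `m` and the coordinates
outside `{i, j, k}` are those of `x`; a coordinate `a ∈ {i, j, k} ∖ {m}` is `x_a` or `x_a - 1` according as its parity agrees
with that of `x_m` or not. -/
def linkBase (i j k : Fin d) (ℓ : Edge d L) : Site d L := fun a =>
  if (a = i ∨ a = j ∨ a = k) ∧ a ≠ ℓ.2 ∧ sitePar ℓ.1 a ≠ sitePar ℓ.1 ℓ.2 then ℓ.1 a - 1 else ℓ.1 a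

/-- Parity of a successor coordinate (even `L`). -/
theorem sitePar_apply_of_eq_add_one (hL : Even L) (x β : Site d L) (a : Fin d) (h : x a = β a + 1) :
    sitePar x a = sitePar β a + 1 := by
  simp only [sitePar, h]
  rw [ZMod.cast_add (even_iff_two_dvd.mp hL), ZMod.cast_one (even_iff_two_dvd.mp hL)]

/-- **The owner lemma.**  If `β` is a cube base, `m ∈ {i,j,k}`, and `x` agrees with `β` at `m` and outside `{i,j,k}` and is
`β_a` or `β_a + 1` at the other two pattern coordinates, then the link `(x, m)` is owned by `β`. -/
theorem linkBase_eq [NeZero L] (hL : Even L) {i j k : Fin d} {β : Site d L} (hβ : β ∈ cubeBases i j k) {m : Fin d}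
    (hm : m = i ∨ m = j ∨ m = k) (x : Site d L) (hxm : x m = β m)
    (hx : ∀ a, (a = i ∨ a = j ∨ a = k) → a ≠ m → x a = β a ∨ x a = β a + 1)
    (hx' : ∀ a, ¬ (a = i ∨ a = j ∨ a = k) → x a = β a) : linkBase i j k (x, m) = β := by
  funext a
  unfold linkBase
  dsimp only
  by_cases hD : (a = i ∨ a = j ∨ a = k)
  · by_cases ham : a = m
    · subst ham
      simp [hxm]
    · have hpar : sitePar β a = sitePar β m := sitePar_eq_of_mem_cubeBases hβ hD hm
      have hxmpar : sitePar x m = sitePar β m := by simp only [sitePar, hxm]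
      rcases hx a hD ham with h | h
      · have hxa : sitePar x a = sitePar x m := by
          rw [hxmpar, ← hpar]; simp only [sitePar, h]
        simp [hxa, h]
      · have hxa : sitePar x a ≠ sitePar x m := by
          rw [hxmpar, ← hpar, sitePar_apply_of_eq_add_one hL x β a h]
          exact fun h' => one_ne_zero (add_eq_left.mp h')
        rw [if_pos ⟨hD, ham, hxa⟩, h, add_sub_cancel_right]
  · rw [if_neg (fun h => hD h.1), hx' a hD]

/-- The link `(β, m)` is owned by `β`. -/
theorem linkBase_self [NeZero L] (hL : Even L) {i j k : Fin d} {β : Site d L} (hβ : β ∈ cubeBases i j k) {m : Fin d}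
    (hm : m = i ∨ m = j ∨ m = k) : linkBase i j k (β, m) = β :=
  linkBase_eq hL hβ hm β rfl (fun _ _ _ => Or.inl rfl) (fun _ _ => rfl)

/-- The link `(β + e_a, m)` (`a ∈ {i,j,k}`, `a ≠ m`) is owned by `β`. -/
theorem linkBase_shift [NeZero L] (hL : Even L) {i j k : Fin d} {β : Site d L} (hβ : β ∈ cubeBases i j k) {m a : Fin d}
    (hm : m = i ∨ m = j ∨ m = k) (ha : a = i ∨ a = j ∨ a = k) (ham : a ≠ m) : linkBase i j k (β.shift a, m) = β := by
  refine linkBase_eq hL hβ hm (β.shift a) (shift_apply_of_ne β (Ne.symm ham)) (fun a' _ _ => ?_) (fun a' ha' => ?_)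
  · by_cases h : a' = a
    · subst h; exact Or.inr (shift_apply_self β a')
    · exact Or.inl (shift_apply_of_ne β h)
  · exact shift_apply_of_ne β (fun h : a' = a => ha' (h ▸ ha))

/-- The link `(β + e_a + e_c, m)` (`a, c ∈ {i,j,k} ∖ {m}`, `a ≠ c`) is owned by `β`. -/
theorem linkBase_shift_shift [NeZero L] (hL : Even L) {i j k : Fin d} {β : Site d L} (hβ : β ∈ cubeBases i j k)
    {m a c : Fin d} (hm : m = i ∨ m = j ∨ m = k) (ha : a = i ∨ a = j ∨ a = k) (hc : c = i ∨ c = j ∨ c = k) (ham : a ≠ m)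
    (hcm : c ≠ m) (hac : a ≠ c) : linkBase i j k ((β.shift a).shift c, m) = β := by
  refine linkBase_eq hL hβ hm ((β.shift a).shift c) ?_ (fun a' _ _ => ?_) (fun a' ha' => ?_)
  · rw [shift_apply_of_ne _ (Ne.symm hcm), shift_apply_of_ne _ (Ne.symm ham)]
  · by_cases h1 : a' = c
    · subst h1
      rw [shift_apply_self, shift_apply_of_ne _ (Ne.symm hac)]
      exact Or.inr rfl
    · rw [shift_apply_of_ne _ h1]
      by_cases h2 : a' = a
      · subst h2; exact Or.inr (shift_apply_self β a')
      · exact Or.inl (shift_apply_of_ne β h2)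
  · rw [shift_apply_of_ne _ (fun h : a' = c => ha' (h ▸ hc)), shift_apply_of_ne _ (fun h : a' = a => ha' (h ▸ ha))]

/-- **The link set of the pattern cube `β`**: the links in the directions `{i,j,k}` owned by `β` (a fibre of `linkBase`, so
distinct cubes have disjoint link sets). -/
def cubeFiber [NeZero L] (i j k : Fin d) (β : Site d L) : Finset (Edge d L) :=
  univ.filter fun ℓ => (ℓ.2 = i ∨ ℓ.2 = j ∨ ℓ.2 = k) ∧ linkBase i j k ℓ = β

/-- Membership in `cubeFiber`. -/
theorem mem_cubeFiber [NeZero L] {i j k : Fin d} {β : Site d L} {ℓ : Edge d L} :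
    ℓ ∈ cubeFiber i j k β ↔ (ℓ.2 = i ∨ ℓ.2 = j ∨ ℓ.2 = k) ∧ linkBase i j k ℓ = β := by
  simp [cubeFiber]

/-- Distinct cubes have disjoint link sets. -/
theorem disjoint_cubeFiber [NeZero L] (i j k : Fin d) {β β' : Site d L} (h : β ≠ β') :
    Disjoint (cubeFiber i j k β) (cubeFiber i j k β') := by
  rw [Finset.disjoint_left]
  intro ℓ h1 h2
  rw [mem_cubeFiber] at h1 h2
  exact h (h1.2.symm.trans h2.2)

/-! ### The pattern is the disjoint union of the cubes -/

/-- The three admissible (first direction, second direction, normal direction) triples. -/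
theorem dirs_cases {i j k a c m : Fin d} (hij : i < j) (hjk : j < k) (ha : a = i ∨ a = j ∨ a = k)
    (hc : c = i ∨ c = j ∨ c = k) (hm : m = i ∨ m = j ∨ m = k) (hac : a < c) (hma : m ≠ a) (hmc : m ≠ c) :
    (a = i ∧ c = j ∧ m = k) ∨ (a = i ∧ c = k ∧ m = j) ∨ (a = j ∧ c = k ∧ m = i) := by
  have hik := hij.trans hjk
  rw [Fin.lt_def] at hij hjk hik hac
  rcases ha with rfl | rfl | rfl <;> rcases hc with rfl | rfl | rfl <;> rcases hm with rfl | rfl | rfl <;>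
    first | exact Or.inl ⟨rfl, rfl, rfl⟩ | exact Or.inr (Or.inl ⟨rfl, rfl, rfl⟩) | exact Or.inr (Or.inr ⟨rfl, rfl, rfl⟩) |
      (exfalso; first | exact hma rfl | exact hmc rfl | omega)

/-- `β + e_m` with the `m`-th coordinate lowered by one is a predecessor: `(update x m (x m - 1)) + e_m = x`. -/
theorem shift_update_sub_one (x : Site d L) (m : Fin d) : Site.shift (Function.update x m (x m - 1)) m = x := by
  funext a
  by_cases h : a = m
  · subst h; rw [shift_apply_self, Function.update_self, sub_add_cancel]
  · rw [shift_apply_of_ne _ h, Function.update_of_ne h]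

/-- Its parity vector. -/
theorem sitePar_update_sub_one (hL : Even L) (x : Site d L) (m : Fin d) :
    sitePar (Function.update x m (x m - 1)) = sitePar x + Pi.single m 1 := by
  have h := sitePar_shift hL (Function.update x m (x m - 1)) m
  rw [shift_update_sub_one] at h
  rw [h, par_add_add_cancel]

/-- **The equal-parity cube pattern is the union of the faces of its cubes.** -/
theorem cubePattern_eq_biUnion [NeZero L] (hL : Even L) {i j k : Fin d} (hij : i < j) (hjk : j < k) :
    cubePattern (dirs3 i j k) (parClass i j k) =
      (cubeBases (L := L) i j k).biUnion (cubeFaces hij (hij.trans hjk) hjk) := by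
  have hik := hij.trans hjk
  ext p
  rw [mem_cubePattern, Finset.mem_biUnion]
  constructor
  · rintro ⟨ha, hc, m, hm, hma, hmc, hpar⟩
    rw [mem_dirs3] at ha hc hm
    obtain ⟨x, ⟨⟨a, c⟩, hac⟩⟩ := p
    have hac' : a < c := hac
    rcases hpar with hpar | hpar
    · refine ⟨x, mem_cubeBases.2 hpar, ?_⟩
      rcases dirs_cases hij hjk ha hc hm hac' hma hmc with ⟨rfl, rfl, rfl⟩ | ⟨rfl, rfl, rfl⟩ | ⟨rfl, rfl, rfl⟩ <;>
        simp [cubeFaces]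
    · refine ⟨Function.update x m (x m - 1), mem_cubeBases.2 (by rwa [sitePar_update_sub_one hL]), ?_⟩
      have hx : x = Site.shift (Function.update x m (x m - 1)) m := (shift_update_sub_one x m).symm
      rcases dirs_cases hij hjk ha hc hm hac' hma hmc with ⟨rfl, rfl, rfl⟩ | ⟨rfl, rfl, rfl⟩ | ⟨rfl, rfl, rfl⟩ <;>
        · simp only [cubeFaces, Finset.mem_insert, Finset.mem_singleton, Prod.mk.injEq]
          rw [← hx]
          simp
  · rintro ⟨β, hβ, hp⟩
    have hβ' := mem_cubeBases.1 hβ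
    simp only [cubeFaces, Finset.mem_insert, Finset.mem_singleton] at hp
    have hi : i ∈ dirs3 i j k := mem_dirs3.2 (Or.inl rfl)
    have hj : j ∈ dirs3 i j k := mem_dirs3.2 (Or.inr (Or.inl rfl))
    have hk : k ∈ dirs3 i j k := mem_dirs3.2 (Or.inr (Or.inr rfl))
    rcases hp with rfl | rfl | rfl | rfl | rfl | rfl
    · exact ⟨hi, hj, k, hk, hik.ne', hjk.ne', Or.inl hβ'⟩
    · exact ⟨hi, hj, k, hk, hik.ne', hjk.ne', Or.inr (by rwa [sitePar_shift hL, par_add_add_cancel])⟩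
    · exact ⟨hi, hk, j, hj, hij.ne', hjk.ne, Or.inl hβ'⟩
    · exact ⟨hi, hk, j, hj, hij.ne', hjk.ne, Or.inr (by rwa [sitePar_shift hL, par_add_add_cancel])⟩
    · exact ⟨hj, hk, i, hi, hij.ne, hik.ne, Or.inl hβ'⟩
    · exact ⟨hj, hk, i, hi, hij.ne, hik.ne, Or.inr (by rwa [sitePar_shift hL, par_add_add_cancel])⟩

/-- The first link of a face of the cube `β` is owned by `β`. -/
theorem linkBase_face [NeZero L] (hL : Even L) {i j k : Fin d} (hij : i < j) (hjk : j < k) {β : Site d L}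
    (hβ : β ∈ cubeBases i j k) {p : Plaquette d L} (hp : p ∈ cubeFaces hij (hij.trans hjk) hjk β) :
    linkBase i j k (p.1, p.2.1.1) = β := by
  have hik := hij.trans hjk
  simp only [cubeFaces, Finset.mem_insert, Finset.mem_singleton] at hp
  rcases hp with rfl | rfl | rfl | rfl | rfl | rfl
  · exact linkBase_self hL hβ (Or.inl rfl)
  · exact linkBase_shift hL hβ (Or.inl rfl) (Or.inr (Or.inr rfl)) hik.ne'
  · exact linkBase_self hL hβ (Or.inl rfl)
  · exact linkBase_shift hL hβ (Or.inl rfl) (Or.inr (Or.inl rfl)) hij.ne'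
  · exact linkBase_self hL hβ (Or.inr (Or.inl rfl))
  · exact linkBase_shift hL hβ (Or.inr (Or.inl rfl)) (Or.inl rfl) hij.ne

/-- **Distinct pattern cubes share no face.** -/
theorem pairwiseDisjoint_cubeFaces [NeZero L] (hL : Even L) {i j k : Fin d} (hij : i < j) (hjk : j < k) :
    ((cubeBases (L := L) i j k) : Set (Site d L)).PairwiseDisjoint (cubeFaces hij (hij.trans hjk) hjk) := by
  intro β hβ β' hβ' hne
  rw [Function.onFun, Finset.disjoint_left]
  intro p hp hp'
  exact hne ((linkBase_face hL hij hjk hβ hp).symm.trans (linkBase_face hL hij hjk hβ' hp'))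

end Summit.Ventures.YMGap.Census

end
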